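/-
Copyright (c) 2026. All rights reserved.
Released under Apache 2.0 license as described in the file LICENSE.
Authors: abc-iut cell, WAVE-5 prover seat abc-iut-w5-d180 (gen 10).
-/
import Literature.IUT.LogVolume.UnitRadicalDifferent
import Mathlib.RingTheory.DedekindDomain.Different
import Mathlib.FieldTheory.Minpoly.IsIntegrallyClosed
import HarnessLib

/-!
# The different of a `p`-adic field containing a `p`-th root of a unit `u` with `u^{p−1} ≢ 1 (mod p²)`, EXACTLY:
# `d_K = (e + e/p − 1)/e` whenever `p² ∤ e` (the case «W2» of the wild local type, upper side)

Classical local algebra (J.-P. Serre, *Corps locaux*, Ch. III §6 Prop. 13 and Cor. 2 of Prop. 11 (Euler: `f′(x) ∈ 𝔇`);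
E. Hecke, *Vorlesungen*, §39), in the norm-side setting of the cell's [IUTchIV] §1 files (`e = absRamificationIdx p K`,
`d = differentOrd p K`, `ord(p) = 1`). PROOF-ONLY sequel (no definition, no `Prop` fact, no instance) of abc-iut-W-neg-1's
`UnitRadicalDifferent.lean`, which proves the LOWER bound `(e + e/p − 1)/e ≤ d_K` for a field `K ∋ y` with `y^p = u`,
`‖u^{p−1} − 1‖ = p⁻¹`, via the subfield `V = ℚ_p(x)`, `x = y^{p−1} − 1` (`e_V = p`, `d_V ≥ 1`) and [IUTchIV] Prop. 1.3 (i).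
HERE the matching UPPER bound:

* §1 `norm_le_rpow_neg_differentOrd_of_mem_different`, `differentOrd_le_of_mem_different` — an element `z ∈ 𝔇_K` with
  `‖z‖ ≥ p^{−c}` forces `d_K ≤ c` (`d = ord` of a generator);
* §2 **`differentOrd_le_of_pow_prime_eq_unit`** — `p² ∤ e_K ⇒ d_K ≤ (e + e/p − 1)/e`: (a) `d_V ≤ 1`, since `x` is a root of the
  Eisenstein polynomial `g = (X+1)^p − u^{p−1}`, which IS its minimal polynomial (`[V:ℚ_p] = p`), so Euler's lemma (Mathlib
  `aeval_derivative_mem_differentIdeal`) puts `g′(x) = p·(x+1)^{p−1}`, of norm `p⁻¹`, in `𝔇_V`; (b) `K/V` is TAMELY ramified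
  (`e(K/V) = e_K/p` is prime to `p` iff `p² ∤ e_K`), so the tame EQUALITY of [IUTchIV] Prop. 1.3 (i) (`prop13i_holds`:
  `d_K = d_V + (e(K/V) − 1)/e_K`) gives `d_K ≤ 1 + (e_K/p − 1)/e_K`;
  **`differentOrd_eq_of_pow_prime_eq_unit`** — with W-neg-1's lower bound: **`d_K = (e + e/p − 1)/e` EXACTLY**, i.e.
  `v_K(𝔇_{K/ℚ_p}) = e + e/p − 1` (the cell's desk value `δ_w = (e_t − 1) + e_t·δ_W`, `(e_W, δ_W) = (6, 7), (20, 23)` of W-num-2's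
  N1-WILD-EXACT, type W2; GAP G-Wnum2-1 (ii), now two-sided); `differentOrd_le_one_add_inv_sub_inv_of_pow_prime_eq_unit` — the same as
  `d_K ≤ 1 + 1/p − 1/e_K`.

Consumer: the abc-iut R-W window table at the wild packets `p ∈ {3, 5}`, `p ∣ t`, `v_p(u^{p−1} − 1) = 1` (type W2), where the
genuine completions have `e = p(p−1)·r·l` (`p² ∤ e`). Nothing here is disputed mathematics; no abc claim.
[cite: SerreLocalFields1979, Ch. III §6 Prop. 13; Cor. 2 of Prop. 11] [cite: NeukirchANT1999, Ch. III (2.4)]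
[cite: Mochizuki2012, IUTchIV Prop. 1.3 (i) p. 11]
-/

noncomputable section

open Metric Set IsLocalRing Module Polynomial
open scoped NormedField IntermediateField

namespace Literature.IUT.LogVolume

/-! ## §1 A bound on `d` from one element of the different -/

section Generic

variable (p : ℕ) [Fact p.Prime]
variable (K : Type*) [NontriviallyNormedField K] [NormedAlgebra ℚ_[p] K] [IsUltrametricDist K] [ProperSpace K]

/-- Every element of the different has norm `≤ p^{−d}` (`d = ord(g)` for a generator `g` of the principal ideal `𝔇`).
[cite: SerreLocalFields1979, Ch. III §3] -/
theorem norm_le_rpow_neg_differentOrd_of_mem_different {z : Valued.integer K} (hz : z ∈ different p K) :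
    ‖(z : K)‖ ≤ (p : ℝ) ^ (-differentOrd p K) := by
  obtain ⟨g, hg⟩ := exists_different_eq_span p K
  have hg0 : g ≠ 0 := generator_ne_zero p K hg
  rw [← norm_eq_rpow_neg_differentOrd p K hg hg0]
  rw [hg] at hz
  exact norm_le_of_mem_span_singleton K hz

/-- **An element `z ∈ 𝔇` with `p^{−c} ≤ ‖z‖` forces `d ≤ c`.** [cite: SerreLocalFields1979, Ch. III §3] -/
theorem differentOrd_le_of_mem_different {z : Valued.integer K} (hz : z ∈ different p K) {c : ℝ}
    (hc : (p : ℝ) ^ (-c) ≤ ‖(z : K)‖) : differentOrd p K ≤ c := by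
  have hp1 : (1 : ℝ) < p := by exact_mod_cast (Fact.out : p.Prime).one_lt
  have h := hc.trans (norm_le_rpow_neg_differentOrd_of_mem_different p K hz)
  have h' := (Real.rpow_le_rpow_left_iff hp1).mp h
  linarith

end Generic

/-! ## §2 The unit radical: `d_K ≤ (e + e/p − 1)/e`, hence equality -/

section Unit

variable (p : ℕ) [Fact p.Prime]
variable {K : Type} [NontriviallyNormedField K] [NormedAlgebra ℚ_[p] K] [IsUltrametricDist K] [ProperSpace K]
variable {u : ℚ_[p]} (hu : ‖u ^ (p - 1) - 1‖ = (p : ℝ)⁻¹) {y : K} (hy : y ^ p = algebraMap ℚ_[p] K u)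

include hu hy

/-- **`d_K ≤ (e + e/p − 1)/e` when `K ∋ y = u^{1/p}`, `u^{p−1} ≢ 1 (mod p²)`, and `p² ∤ e_K`.** With `x = y^{p−1} − 1` and
`V = ℚ_p(x) ⊆ K`: `e_V = p` (abc-iut-W-neg-1), the Eisenstein polynomial `g = (X+1)^p − u^{p−1}` is the minimal polynomial of
`x`, so `g′(x) = p·(x+1)^{p−1} ∈ 𝔇_V` (Euler) has norm `p⁻¹` and `d_V ≤ 1`; `e(K/V) = e_K/p` is prime to `p`, so [IUTchIV]
Prop. 1.3 (i) holds with EQUALITY: `d_K = d_V + (e_K/p − 1)/e_K ≤ (e_K + e_K/p − 1)/e_K`.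
[cite: SerreLocalFields1979, Ch. III §6 Prop. 13; Cor. 2 of Prop. 11] [cite: Mochizuki2012, IUTchIV Prop. 1.3 (i) p. 11] -/
theorem differentOrd_le_of_pow_prime_eq_unit (he2 : ¬ p ^ 2 ∣ absRamificationIdx p K) :
    differentOrd p K ≤
      ((absRamificationIdx p K + absRamificationIdx p K / p - 1 : ℕ) : ℝ) / (absRamificationIdx p K : ℝ) := by
  have hpp : p.Prime := Fact.out
  have hp1 : (1 : ℝ) < p := by exact_mod_cast hpp.one_lt
  have hp0 : (0 : ℝ) < p := by positivity
  haveI : FiniteDimensional ℚ_[p] K := FiniteDimensional.of_locallyCompactSpace ℚ_[p]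
  set x : K := y ^ (p - 1) - 1 with hxdef
  have hxn : ‖x‖ = (p : ℝ) ^ (-(1 / (p : ℝ))) := norm_pow_sub_one_pred_sub_one_of_pow_prime_eq_unit p hu hy
  have hxlt : ‖x‖ < 1 := by
    rw [hxn]
    exact Real.rpow_lt_one_of_one_lt_of_neg hp1 (by
      have : (0 : ℝ) < 1 / (p : ℝ) := by positivity
      linarith)
  have hx1n : ‖x + 1‖ = 1 := by
    have hne : ‖x‖ ≠ ‖(1 : K)‖ := by rw [norm_one]; exact hxlt.ne
    rw [IsUltrametricDist.norm_add_eq_max_of_norm_ne_norm hne, norm_one, max_eq_right hxlt.le]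
  -- the subfield `V = ℚ_p(x)` (as in `UnitRadicalDifferent`)
  haveI : FiniteDimensional ℚ_[p] ℚ_[p]⟮x⟯ := inferInstance
  haveI : ProperSpace ℚ_[p]⟮x⟯ := FiniteDimensional.proper ℚ_[p] ℚ_[p]⟮x⟯
  letI : NormedAlgebra ℚ_[p]⟮x⟯ K :=
    { (IntermediateField.toAlgebra ℚ_[p]⟮x⟯ : Algebra ℚ_[p]⟮x⟯ K) with
      norm_smul_le := fun v z => by
        rw [Algebra.smul_def, norm_mul]
        rfl }
  have hxV : x ∈ ℚ_[p]⟮x⟯ := IntermediateField.mem_adjoin_simple_self ℚ_[p] x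
  -- `p ∣ e_V`
  have hpV : p ∣ absRamificationIdx p ℚ_[p]⟮x⟯ :=
    prime_dvd_absRamificationIdx_of_norm_eq_rpow p (x := (⟨x, hxV⟩ : ℚ_[p]⟮x⟯)) hxn
  -- `x` is a root of the monic `g = (X + 1)^p − u^{p−1}` of degree `p`
  have hx1 : (x + 1) ^ p = algebraMap ℚ_[p] K (u ^ (p - 1)) := by
    rw [hxdef, sub_add_cancel, ← pow_mul, mul_comm, pow_mul, hy, map_pow]
  have hint : IsIntegral ℚ_[p] x := Algebra.IsIntegral.isIntegral x
  set g : ℚ_[p][X] := (X + C 1) ^ p - C (u ^ (p - 1)) with hgdef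
  have hgdeg : g.natDegree = p := by
    rw [hgdef, natDegree_sub_C, natDegree_pow, natDegree_X_add_C, mul_one]
  have hgmonic : g.Monic := by
    have hdeg1 : ((X + C (1 : ℚ_[p])) ^ p).degree = (p : WithBot ℕ) := by
      rw [degree_pow, degree_X_add_C, nsmul_one]
    rw [hgdef]
    refine Monic.sub_of_left ((monic_X_add_C 1).pow p) ?_
    rw [hdeg1]
    exact lt_of_le_of_lt degree_C_le (by exact_mod_cast hpp.pos)
  have hg0 : g ≠ 0 := hgmonic.ne_zero
  have hroot : aeval x g = 0 := by
    rw [hgdef, map_sub, map_pow, map_add, aeval_X, aeval_C, aeval_C, map_one, hx1, sub_self]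
  have hmin_dvd : minpoly ℚ_[p] x ∣ g := minpoly.dvd ℚ_[p] x hroot
  have hdeg : Module.finrank ℚ_[p] ℚ_[p]⟮x⟯ ≤ p := by
    rw [IntermediateField.adjoin.finrank hint]
    calc (minpoly ℚ_[p] x).natDegree ≤ g.natDegree := natDegree_le_of_dvd hmin_dvd hg0
      _ = p := hgdeg
  -- `e_V = p`, hence `[V : ℚ_p] = p` and `minpoly = g`
  have heV : absRamificationIdx p ℚ_[p]⟮x⟯ = p := by
    have hfi := absRamificationIdx_mul_residueDegree p ℚ_[p]⟮x⟯
    have hf := residueDegree_pos p ℚ_[p]⟮x⟯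
    have hle : absRamificationIdx p ℚ_[p]⟮x⟯ ≤ p := by
      calc absRamificationIdx p ℚ_[p]⟮x⟯ ≤ absRamificationIdx p ℚ_[p]⟮x⟯ * residueDegree p ℚ_[p]⟮x⟯ :=
            Nat.le_mul_of_pos_right _ hf
        _ = Module.finrank ℚ_[p] ℚ_[p]⟮x⟯ := hfi
        _ ≤ p := hdeg
    exact le_antisymm hle (Nat.le_of_dvd (absRamificationIdx_pos p _) hpV)
  have hfinrank : Module.finrank ℚ_[p] ℚ_[p]⟮x⟯ = p := by
    refine le_antisymm hdeg ?_
    have hfi := absRamificationIdx_mul_residueDegree p ℚ_[p]⟮x⟯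
    have hf := residueDegree_pos p ℚ_[p]⟮x⟯
    calc p = absRamificationIdx p ℚ_[p]⟮x⟯ := heV.symm
      _ ≤ absRamificationIdx p ℚ_[p]⟮x⟯ * residueDegree p ℚ_[p]⟮x⟯ := Nat.le_mul_of_pos_right _ hf
      _ = Module.finrank ℚ_[p] ℚ_[p]⟮x⟯ := hfi
  have hmin_eq : minpoly ℚ_[p] x = g := by
    symm
    refine Polynomial.eq_of_monic_of_dvd_of_natDegree_le (minpoly.monic hint) hgmonic hmin_dvd ?_
    rw [hgdeg, ← IntermediateField.adjoin.finrank hint, hfinrank]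
  -- Euler: `m′(x) ∈ 𝔇_V` for `m` the minimal polynomial of `x` over `ℤ_p`
  set x' : ℚ_[p]⟮x⟯ := IntermediateField.AdjoinSimple.gen ℚ_[p] x with hx'def
  have hx'K : ((x' : ℚ_[p]⟮x⟯) : K) = x := IntermediateField.AdjoinSimple.coe_gen ℚ_[p] x
  have hx'n : ‖x'‖ ≤ 1 := by
    change ‖((x' : ℚ_[p]⟮x⟯) : K)‖ ≤ 1
    rw [hx'K]
    exact hxlt.le
  set xi : Valued.integer ℚ_[p]⟮x⟯ := ⟨x', Valued.integer.mem_iff.mpr hx'n⟩ with hxidef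
  have hxiV : ((xi : Valued.integer ℚ_[p]⟮x⟯) : ℚ_[p]⟮x⟯) = x' := rfl
  haveI : Algebra.IsAlgebraic ℚ_[p] ℚ_[p]⟮x⟯ := Algebra.IsAlgebraic.of_finite ℚ_[p] _
  haveI : Algebra.IsSeparable ℚ_[p] ℚ_[p]⟮x⟯ := inferInstance
  have hgen : Algebra.adjoin ℚ_[p] {x'} = ⊤ := by
    have h := (IntermediateField.adjoin.powerBasis hint).adjoin_gen_eq_top
    rwa [IntermediateField.adjoin.powerBasis_gen] at h
  have hmem : aeval xi (derivative (minpoly ℤ_[p] xi)) ∈ different p ℚ_[p]⟮x⟯ := by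
    rw [different_eq]
    exact aeval_derivative_mem_differentIdeal ℤ_[p] ℚ_[p] ℚ_[p]⟮x⟯ xi hgen
  -- identify `m` with `g` over `ℚ_p`
  have hintZ : IsIntegral ℤ_[p] xi := (isIntegral_integer p ℚ_[p]⟮x⟯).isIntegral xi
  set ι : Valued.integer ℚ_[p]⟮x⟯ →ₐ[ℤ_[p]] ℚ_[p]⟮x⟯ := IsScalarTower.toAlgHom ℤ_[p] (Valued.integer ℚ_[p]⟮x⟯) ℚ_[p]⟮x⟯
    with hιdef
  have hι : ∀ z, ι z = (z : ℚ_[p]⟮x⟯) := fun z => rfl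
  have hιinj : Function.Injective ι := fun a b h => Subtype.ext (by rw [← hι a, ← hι b, h])
  have hintZ' : IsIntegral ℤ_[p] x' := by
    have h := (isIntegral_algHom_iff ι hιinj).mpr hintZ
    rwa [hι, hxiV] at h
  have hminZ : (minpoly ℤ_[p] xi).map (algebraMap ℤ_[p] ℚ_[p]) = g := by
    have h1 : minpoly ℚ_[p] x' = (minpoly ℤ_[p] x').map (algebraMap ℤ_[p] ℚ_[p]) :=
      minpoly.isIntegrallyClosed_eq_field_fractions' ℚ_[p] hintZ'
    have h2 : minpoly ℤ_[p] (ι xi) = minpoly ℤ_[p] xi := minpoly.algHom_eq ι hιinj xi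
    have h3 : minpoly ℚ_[p] x' = minpoly ℚ_[p] x := by
      have := minpoly.algHom_eq (IntermediateField.val ℚ_[p]⟮x⟯) Subtype.val_injective x'
      rw [← this]
      rfl
    rw [hι] at h2
    rw [hxiV] at h2
    rw [← h2, ← h1, h3, hmin_eq]
  -- evaluate: `m′(x) = g′(x) = p·(x+1)^{p−1}` in `V`
  have hderg : derivative g = C (p : ℚ_[p]) * (X + C 1) ^ (p - 1) := by
    rw [hgdef, derivative_sub, derivative_C, sub_zero, derivative_pow, derivative_X_add_C, mul_one]
  have heval : ((aeval xi (derivative (minpoly ℤ_[p] xi)) : Valued.integer ℚ_[p]⟮x⟯) : ℚ_[p]⟮x⟯) =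
      (p : ℚ_[p]⟮x⟯) * (x' + 1) ^ (p - 1) := by
    rw [← hι, ← aeval_algHom_apply, hι, hxiV, ← aeval_map_algebraMap ℚ_[p] x' (derivative (minpoly ℤ_[p] xi)),
      ← derivative_map, hminZ, hderg, map_mul, aeval_C, map_natCast, map_pow, map_add, aeval_X, aeval_C, map_one]
  -- its norm is `p⁻¹`
  have hx'1 : ‖x' + 1‖ = 1 := by
    change ‖((x' + 1 : ℚ_[p]⟮x⟯) : K)‖ = 1
    push_cast
    rw [hx'K]
    exact hx1n
  have hpn : ‖(p : ℚ_[p]⟮x⟯)‖ = (p : ℝ)⁻¹ := by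
    rw [norm_natCast_eq_padicNorm p ℚ_[p]⟮x⟯ p, Padic.norm_p]
  have hnorm : ‖((aeval xi (derivative (minpoly ℤ_[p] xi)) : Valued.integer ℚ_[p]⟮x⟯) : ℚ_[p]⟮x⟯)‖ = (p : ℝ)⁻¹ := by
    rw [heval, norm_mul, norm_pow, hx'1, one_pow, mul_one, hpn]
  -- hence `d_V ≤ 1`
  have hdV : differentOrd p ℚ_[p]⟮x⟯ ≤ 1 := by
    refine differentOrd_le_of_mem_different p ℚ_[p]⟮x⟯ hmem ?_
    rw [hnorm, Real.rpow_neg_one]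
  -- `e(K/V) = e_K/p` is prime to `p`: the extension `K/V` is tamely ramified
  obtain ⟨-, heq⟩ := prop13i_holds p ℚ_[p]⟮x⟯ K inferInstance
  have hrel : relRamificationIdx p ℚ_[p]⟮x⟯ K * p = absRamificationIdx p K := by
    have h := relRamificationIdx_mul p ℚ_[p]⟮x⟯ K
    rwa [heV] at h
  have hrel1 := relRamificationIdx_pos p ℚ_[p]⟮x⟯ K
  set r := relRamificationIdx p ℚ_[p]⟮x⟯ K with hrdef
  have htame : IsTamelyRamified p ℚ_[p]⟮x⟯ K := by
    intro hpr
    change p ∣ relRamificationIdx p ℚ_[p]⟮x⟯ K at hpr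
    rw [← hrdef] at hpr
    obtain ⟨s, hs⟩ := hpr
    exact he2 ⟨s, by rw [← hrel, hs]; ring⟩
  have hdK := heq htame
  have hdiv : absRamificationIdx p K / p = r := Nat.div_eq_of_eq_mul_left hpp.pos hrel.symm
  have he := absRamificationIdx_pos p K
  have he0 : (0 : ℝ) < absRamificationIdx p K := by exact_mod_cast he
  rw [hdiv]
  have hcast : ((absRamificationIdx p K + r - 1 : ℕ) : ℝ) = (absRamificationIdx p K : ℝ) + r - 1 := by
    rw [Nat.cast_sub (by omega), Nat.cast_add, Nat.cast_one]
  rw [hcast, hdK]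
  calc differentOrd p ℚ_[p]⟮x⟯ + ((r : ℝ) - 1) / absRamificationIdx p K
      ≤ 1 + ((r : ℝ) - 1) / absRamificationIdx p K := by gcongr
    _ = ((absRamificationIdx p K : ℝ) + r - 1) / absRamificationIdx p K := by
        field_simp
        ring

/-- **THE W2 DIFFERENT, EXACT: `d_K = (e + e/p − 1)/e`** for a `p`-adic field `K ∋ y`, `y^p = u`, `‖u^{p−1} − 1‖ = p⁻¹`, with
`p² ∤ e_K` — abc-iut-W-neg-1's lower bound `add_div_sub_one_div_le_differentOrd_of_pow_prime_eq_unit` and the upper bound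
`differentOrd_le_of_pow_prime_eq_unit`. Equivalently `v_K(𝔇_{K/ℚ_p}) = e + e/p − 1` (`= 4e/3 − 1` at `p = 3`, `6e/5 − 1` at
`p = 5`: W-num-2's N1-WILD-EXACT type W2, both sides now in the kernel). [cite: SerreLocalFields1979, Ch. III §6 Prop. 13]
[cite: Mochizuki2012, IUTchIV Prop. 1.3 (i) p. 11] -/
theorem differentOrd_eq_of_pow_prime_eq_unit (he2 : ¬ p ^ 2 ∣ absRamificationIdx p K) :
    differentOrd p K =
      ((absRamificationIdx p K + absRamificationIdx p K / p - 1 : ℕ) : ℝ) / (absRamificationIdx p K : ℝ) :=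
  le_antisymm (differentOrd_le_of_pow_prime_eq_unit p hu hy he2)
    (add_div_sub_one_div_le_differentOrd_of_pow_prime_eq_unit p hu hy)

/-- **`d_K ≤ 1 + 1/p − 1/e_K`** (the same bound in closed form: `p ∣ e_K`, so `e_K/p` is exact).
[cite: SerreLocalFields1979, Ch. III §6 Prop. 13] [cite: Mochizuki2012, IUTchIV Prop. 1.3 (i) p. 11] -/
theorem differentOrd_le_one_add_inv_sub_inv_of_pow_prime_eq_unit (he2 : ¬ p ^ 2 ∣ absRamificationIdx p K) :
    differentOrd p K ≤ 1 + 1 / (p : ℝ) - 1 / (absRamificationIdx p K : ℝ) := by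
  have hpp : p.Prime := Fact.out
  have h := differentOrd_le_of_pow_prime_eq_unit p hu hy he2
  have he := absRamificationIdx_pos p K
  have he0 : (0 : ℝ) < absRamificationIdx p K := by exact_mod_cast he
  have hp0 : (0 : ℝ) < p := by exact_mod_cast hpp.pos
  -- `p ∣ e_K`
  set x : K := y ^ (p - 1) - 1 with hxdef
  have hxn : ‖x‖ = (p : ℝ) ^ (-(1 / (p : ℝ))) := norm_pow_sub_one_pred_sub_one_of_pow_prime_eq_unit p hu hy
  have hpe : p ∣ absRamificationIdx p K := prime_dvd_absRamificationIdx_of_norm_eq_rpow p hxn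
  obtain ⟨r, hr⟩ := hpe
  have hr1 : 1 ≤ r := by
    rcases Nat.eq_zero_or_pos r with h0 | h0
    · rw [h0, mul_zero] at hr; omega
    · exact h0
  have hdiv : absRamificationIdx p K / p = r := by rw [hr]; exact Nat.mul_div_cancel_left r hpp.pos
  rw [hdiv] at h
  have hcast : ((absRamificationIdx p K + r - 1 : ℕ) : ℝ) = (absRamificationIdx p K : ℝ) + r - 1 := by
    rw [Nat.cast_sub (by omega), Nat.cast_add, Nat.cast_one]
  rw [hcast] at h
  have hrR : (r : ℝ) = (absRamificationIdx p K : ℝ) / p := by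
    rw [hr, Nat.cast_mul]; field_simp
  rw [hrR] at h
  calc differentOrd p K ≤ ((absRamificationIdx p K : ℝ) + (absRamificationIdx p K : ℝ) / p - 1) / absRamificationIdx p K := h
    _ = 1 + 1 / (p : ℝ) - 1 / (absRamificationIdx p K : ℝ) := by
        field_simp

end Unit

end Literature.IUT.LogVolume

end
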